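import Mathlib
import Literature.Computability.AlgebraicComplexity.NestFreeMatchingPoly
import HarnessLib

/-!
# Queue-grid face of `NFP(2n)`, input (A): the positions of the layout-B word (definitions)

Definitions file (objects posited by the line `Cruxes/NNLinearDegreeCofactorHard/Lines/queue_grid_face.lean`, val-idea-7 g6;
SPEC `Lines/queue_grid_face-A-SPEC.md` §2) for the support item stmt-ValiantsHypothesis-26254 (`NFPolytopeQuasiPolyXC`, K1).
Honesty: K1 open → open; stmt-23918 / stmt-24468 CLOSED, untouched; stmt-21181 open; VP ≠ VNP is not moved.

Layout B (memo `Lines/internal_cofactor-NEXT-RUNG-dual.md` §8.3, z = 0): the word on `N = 2((r+1)(2r+1) + j)` letters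
`U^{2r+1} · Π_{s<r} [ U · W(s,0) ⋯ W(s,r−1) · D ] · D^{2r+1} · (UD)^j`, each window `W(s,i)` four letters.  Here we only fix
the STRUCTURED POSITIONS of that word and their bijection with `Fin N`:

* `Pos r j` — `pre t` (preamble, `t < 2r+1`), `frU s` (frame opening stretch `s < r`), `win s i σ` (slot `σ < 4` of window
  `(s,i)`), `frD s` (frame closing stretch `s`), `post t` (postamble), `padU t` / `padD t` (padding pair `t < j`);
* `Pos.pos` — the position in the word: `t`, `R + W s`, `R + W s + 1 + 4i + σ`, `R + W s + 4r + 1`, `R + W r + t`, `G + 2t`,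
  `G + 2t + 1` with `R = 2r+1`, `W = 4r+2`, `G = 2(r+1)(2r+1)`;
* `pos_lt` and the bijection `Pos.equivFin : Pos r j ≃ Fin N` (`(equivFin p).val = pos p`; surjectivity by the division
  algorithm, cardinality by `Pos.sumEquiv`) and its order-compatibility;
* for `r = k + 1 ≥ 1` (SPEC §3–§4): the slot involution `Pos.τ`, the designed matchings `Pos.design X` (= `M_X`), the word
  `Pos.isU X`, the rank potential `Pos.rank X`, the allowed arcs `Pos.allowed` (= `E'`), the read-out coordinates
  `Pos.coord`, their transports `designFin / allowedFin / coordFin` to `Fin N`, and Theorems-side verbatim copies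
  `realOf / suppPts / newt / QGV / qgEdge / patternVec / queueGridPP` of the line file's vocabulary (the farm does not serve
  `Cruxes/` workfiles as imports; the copies agree with the originals by `rfl`).
All definitions were checked by `decide` at `r = 1, 2` in this seat's scratch (involution, fixed-point-free, arcs allowed,
`allowed` = union of the design arcs, `|E'| = 10, 34`, rank constant on arcs and monotone on openers / closers, read-out ↔
`qgEdge ∧ bits`).  Proofs for general `r` are in the sibling files `…QueueGridFaceOrder/Design/NestFree/Rigidity/….lean`.

No instances beyond the derived `DecidableEq`; no notation.  [folklore bookkeeping; the gadget itself is val-idea-7's]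
-/

-- Sub = Summit single-conjunct layout: the duplicated namespace component is mandated by the tree.
set_option linter.dupNamespace false

namespace Summit.ValiantsHypothesis.ValiantsHypothesis.Theorems.FifoMatching.QueueGridFace

/-- **Structured positions** of the layout-B word with `r` stretches of `r` windows and `j` padding pairs.
[val-idea-7 g6, memo §8.3; names ours] -/
inductive Pos (r j : ℕ) : Type
  /-- preamble letter `t < 2r+1` (always `U`) -/
  | pre (t : Fin (2 * r + 1)) : Pos r j
  /-- the frame letter opening stretch `s` (always `U`) -/
  | frU (s : Fin r) : Pos r j
  /-- slot `σ` of window `(s, i)` -/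
  | win (s i : Fin r) (σ : Fin 4) : Pos r j
  /-- the frame letter closing stretch `s` (always `D`) -/
  | frD (s : Fin r) : Pos r j
  /-- postamble letter `t < 2r+1` (always `D`) -/
  | post (t : Fin (2 * r + 1)) : Pos r j
  /-- the `U` of padding pair `t` -/
  | padU (t : Fin j) : Pos r j
  /-- the `D` of padding pair `t` -/
  | padD (t : Fin j) : Pos r j
  deriving DecidableEq

namespace Pos

variable {r j : ℕ}

/-- The position of a structured position in the word (`R = 2r+1`, `W = 4r+2`, `G = 2(r+1)(2r+1)`). [memo §8.3] -/
def pos : Pos r j → ℕ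
  | pre t => t
  | frU s => (2 * r + 1) + (4 * r + 2) * s
  | win s i σ => (2 * r + 1) + (4 * r + 2) * s + (1 + 4 * i + σ)
  | frD s => (2 * r + 1) + (4 * r + 2) * s + (4 * r + 1)
  | post t => (2 * r + 1) + (4 * r + 2) * r + t
  | padU t => 2 * ((r + 1) * (2 * r + 1)) + 2 * t
  | padD t => 2 * ((r + 1) * (2 * r + 1)) + 2 * t + 1

/-- unfolding `pos`. -/
@[simp] theorem pos_pre (t : Fin (2 * r + 1)) : (pre t : Pos r j).pos = t := rfl
/-- unfolding `pos`. -/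
@[simp] theorem pos_frU (s : Fin r) : (frU s : Pos r j).pos = (2 * r + 1) + (4 * r + 2) * s := rfl
/-- unfolding `pos`. -/
@[simp] theorem pos_win (s i : Fin r) (σ : Fin 4) :
    (win s i σ : Pos r j).pos = (2 * r + 1) + (4 * r + 2) * s + (1 + 4 * i + σ) := rfl
/-- unfolding `pos`. -/
@[simp] theorem pos_frD (s : Fin r) : (frD s : Pos r j).pos = (2 * r + 1) + (4 * r + 2) * s + (4 * r + 1) := rfl
/-- unfolding `pos`. -/
@[simp] theorem pos_post (t : Fin (2 * r + 1)) : (post t : Pos r j).pos = (2 * r + 1) + (4 * r + 2) * r + t := rfl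
/-- unfolding `pos`. -/
@[simp] theorem pos_padU (t : Fin j) : (padU t : Pos r j).pos = 2 * ((r + 1) * (2 * r + 1)) + 2 * t := rfl
/-- unfolding `pos`. -/
@[simp] theorem pos_padD (t : Fin j) : (padD t : Pos r j).pos = 2 * ((r + 1) * (2 * r + 1)) + 2 * t + 1 := rfl

/-- Inside the stretches: an offset `o < W` of stretch `s < r` lies before stretch `r`'s start. [folklore] -/
theorem stretch_lt (s : Fin r) {o : ℕ} (ho : o < 4 * r + 2) :
    (4 * r + 2) * (s : ℕ) + o < (4 * r + 2) * r :=
  calc (4 * r + 2) * (s : ℕ) + o < (4 * r + 2) * s + (4 * r + 2) := by omega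
    _ = (4 * r + 2) * (s + 1) := by ring
    _ ≤ (4 * r + 2) * r := Nat.mul_le_mul_left _ s.isLt

/-- `W r + (2r+1) + (2r+1) = G`. [arithmetic] -/
theorem gadget_length (r : ℕ) :
    (2 * r + 1) + (4 * r + 2) * r + (2 * r + 1) = 2 * ((r + 1) * (2 * r + 1)) := by ring

/-- Every position is `< N = 2((r+1)(2r+1) + j)`. [memo §8.3] -/
theorem pos_lt (p : Pos r j) : p.pos < 2 * ((r + 1) * (2 * r + 1) + j) := by
  have hG := gadget_length r
  cases p with
  | pre t => have := t.isLt; simp only [pos]; nlinarith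
  | frU s => have := stretch_lt s (o := 0) (by omega); simp only [pos]; omega
  | win s i σ =>
    have := stretch_lt s (o := 1 + 4 * i + σ) (by have := i.isLt; have := σ.isLt; omega)
    simp only [pos]; omega
  | frD s => have := stretch_lt s (o := 4 * r + 1) (by omega); simp only [pos]; omega
  | post t => have := t.isLt; simp only [pos]; omega
  | padU t => have := t.isLt; simp only [pos]; omega
  | padD t => have := t.isLt; simp only [pos]; omega

/-! ### The bijection with `Fin N` -/

/-- `Pos r j` as a sum of its seven index types. [bookkeeping] -/
def sumEquiv (r j : ℕ) :
    Pos r j ≃ Fin (2 * r + 1) ⊕ Fin r ⊕ (Fin r × Fin r × Fin 4) ⊕ Fin r ⊕ Fin (2 * r + 1) ⊕ Fin j ⊕ Fin j where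
  toFun
    | pre t => Sum.inl t
    | frU s => Sum.inr (Sum.inl s)
    | win s i σ => Sum.inr (Sum.inr (Sum.inl (s, i, σ)))
    | frD s => Sum.inr (Sum.inr (Sum.inr (Sum.inl s)))
    | post t => Sum.inr (Sum.inr (Sum.inr (Sum.inr (Sum.inl t))))
    | padU t => Sum.inr (Sum.inr (Sum.inr (Sum.inr (Sum.inr (Sum.inl t)))))
    | padD t => Sum.inr (Sum.inr (Sum.inr (Sum.inr (Sum.inr (Sum.inr t)))))
  invFun
    | Sum.inl t => pre t
    | Sum.inr (Sum.inl s) => frU s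
    | Sum.inr (Sum.inr (Sum.inl (s, i, σ))) => win s i σ
    | Sum.inr (Sum.inr (Sum.inr (Sum.inl s))) => frD s
    | Sum.inr (Sum.inr (Sum.inr (Sum.inr (Sum.inl t)))) => post t
    | Sum.inr (Sum.inr (Sum.inr (Sum.inr (Sum.inr (Sum.inl t))))) => padU t
    | Sum.inr (Sum.inr (Sum.inr (Sum.inr (Sum.inr (Sum.inr t))))) => padD t
  left_inv p := by cases p <;> rfl
  right_inv q := by
    rcases q with t | s | ⟨s, i, σ⟩ | s | t | t | t <;> rfl

/-- `|Pos r j| = N = 2((r+1)(2r+1) + j)` (for the `Fintype` structure transported along `sumEquiv`). [bookkeeping] -/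
theorem card_eq (r j : ℕ) :
    @Fintype.card (Pos r j) (Fintype.ofEquiv _ (sumEquiv r j).symm) = 2 * ((r + 1) * (2 * r + 1) + j) := by
  rw [Fintype.ofEquiv_card]
  simp only [Fintype.card_sum, Fintype.card_prod, Fintype.card_fin]
  ring

/-- **Every `m < N` is a position** (division algorithm: preamble / stretch `s = (m−R)/W`, offset `(m−R) % W` /
postamble / padding parity). [memo §8.3] -/
theorem exists_pos_eq {m : ℕ} (hm : m < 2 * ((r + 1) * (2 * r + 1) + j)) : ∃ p : Pos r j, p.pos = m := by
  have hG := gadget_length r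
  by_cases h1 : m < 2 * r + 1
  · exact ⟨pre ⟨m, h1⟩, rfl⟩
  by_cases h2 : m < (2 * r + 1) + (4 * r + 2) * r
  · -- inside the stretches
    have hW : 0 < 4 * r + 2 := by omega
    set q := m - (2 * r + 1) with hq
    have hqlt : q < (4 * r + 2) * r := by omega
    have hs : q / (4 * r + 2) < r := Nat.div_lt_of_lt_mul hqlt
    have hdm := Nat.div_add_mod q (4 * r + 2)
    have ho : q % (4 * r + 2) < 4 * r + 2 := Nat.mod_lt _ hW
    set s := q / (4 * r + 2) with hsdef
    set o := q % (4 * r + 2) with hodef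
    by_cases ho0 : o = 0
    · exact ⟨frU ⟨s, hs⟩, by simp only [pos]; omega⟩
    by_cases ho1 : o = 4 * r + 1
    · exact ⟨frD ⟨s, hs⟩, by simp only [pos]; omega⟩
    · have ho' : o - 1 < 4 * r := by omega
      have hi : (o - 1) / 4 < r := Nat.div_lt_of_lt_mul (by omega)
      have hdm' := Nat.div_add_mod (o - 1) 4
      have hσ : (o - 1) % 4 < 4 := Nat.mod_lt _ (by omega)
      exact ⟨win ⟨s, hs⟩ ⟨(o - 1) / 4, hi⟩ ⟨(o - 1) % 4, hσ⟩, by simp only [pos]; omega⟩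
  by_cases h3 : m < 2 * ((r + 1) * (2 * r + 1))
  · exact ⟨post ⟨m - ((2 * r + 1) + (4 * r + 2) * r), by omega⟩, by simp only [pos]; omega⟩
  · -- padding
    set q := m - 2 * ((r + 1) * (2 * r + 1)) with hq
    have hdm := Nat.div_add_mod q 2
    have ht : q / 2 < j := by omega
    by_cases hpar : q % 2 = 0
    · exact ⟨padU ⟨q / 2, ht⟩, by simp only [pos]; omega⟩
    · exact ⟨padD ⟨q / 2, ht⟩, by simp only [pos]; omega⟩

/-- The position map into `Fin N`. -/
def toFin (p : Pos r j) : Fin (2 * ((r + 1) * (2 * r + 1) + j)) := ⟨p.pos, p.pos_lt⟩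

/-- `toFin` is a bijection. [bookkeeping: surjective by `exists_pos_eq`, cardinalities agree by `card_eq`] -/
theorem toFin_bijective (r j : ℕ) : Function.Bijective (toFin : Pos r j → Fin (2 * ((r + 1) * (2 * r + 1) + j))) := by
  letI : Fintype (Pos r j) := Fintype.ofEquiv _ (sumEquiv r j).symm
  rw [Fintype.bijective_iff_surjective_and_card]
  refine ⟨fun q => ?_, by rw [card_eq, Fintype.card_fin]⟩
  obtain ⟨p, hp⟩ := exists_pos_eq (r := r) (j := j) q.isLt
  exact ⟨p, Fin.ext hp⟩

/-- **The structured positions are in order-compatible bijection with `Fin N`.** -/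
noncomputable def equivFin (r j : ℕ) : Pos r j ≃ Fin (2 * ((r + 1) * (2 * r + 1) + j)) :=
  Equiv.ofBijective toFin (toFin_bijective r j)

/-- the bijection is the position map. -/
@[simp] theorem equivFin_val (p : Pos r j) : ((equivFin r j p : Fin _) : ℕ) = p.pos := rfl

/-- order compatibility of the bijection. -/
theorem equivFin_lt_equivFin {p q : Pos r j} : equivFin r j p < equivFin r j q ↔ p.pos < q.pos := Iff.rfl

/-- `pos` is injective. -/
theorem pos_injective : Function.Injective (pos : Pos r j → ℕ) := fun _ _ h =>
  (equivFin r j).injective (Fin.ext h)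

/-- positions are equal iff the structured positions are. -/
theorem pos_eq_pos {p q : Pos r j} : p.pos = q.pos ↔ p = q := pos_injective.eq_iff

/-- the value of the inverse bijection. -/
@[simp] theorem pos_symm (q : Fin (2 * ((r + 1) * (2 * r + 1) + j))) : ((equivFin r j).symm q).pos = q := by
  have h := equivFin_val ((equivFin r j).symm q)
  rw [Equiv.apply_symm_apply] at h
  exact h.symm

/-! ### The slot involution: roles `U₁ U₂ D₁ D₂` (= `0 1 2 3`) ↔ slots under a bit -/

/-- Under bit `b` the window reads `UUDD` (`b = true`: role `x` sits at slot `x`) or `DDUU` (`b = false`: role `x` sits at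
slot `x + 2 mod 4`); `τ b` is that correspondence, an involution of `Fin 4` (roles `0 = U₁, 1 = U₂, 2 = D₁, 3 = D₂`).
[memo §8.3: "slot parities U₁ ∈ {0,2}, U₂ ∈ {1,3}, D₁ ∈ {0,2}, D₂ ∈ {1,3}"] -/
def τ (b : Bool) (x : Fin 4) : Fin 4 := if b then x else x + 2

/-- `τ b` is an involution. -/
@[simp] theorem τ_τ (b : Bool) (x : Fin 4) : τ b (τ b x) = x := by
  cases b
  · simp only [τ, Bool.false_eq_true, ↓reduceIte]
    ext; simp only [Fin.val_add]; omega
  · simp [τ]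

/-- values of `τ`: `τ true x = x`. -/
@[simp] theorem τ_true (x : Fin 4) : τ true x = x := by simp [τ]

/-- values of `τ`: `τ false x = x + 2`. -/
@[simp] theorem τ_false (x : Fin 4) : τ false x = x + 2 := by simp [τ]

/-! ### The designs `M_X` (here `r = k + 1 ≥ 1`) -/

variable {k : ℕ}

/-- **The designed matching `M_X`** of the layout-B word of the bit pattern `X` (`X (s,i) = true`: window `(s,i)` reads
`UUDD`; `false`: `DDUU`), as an involution of the structured positions; FIFO pairing (memo §8.3): window `(s+1,i)`'s
`D₁` pops `U₂(s,i−1)` (the frame `U` of stretch `s` for `i = 0`), its `D₂` pops `U₁(s,i)`, the frame `D` of stretch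
`s+1` pops `U₂(s,r−1)`; the preamble feeds stretch `0`, stretch `r−1` feeds the postamble, padding pairs match each other.
[val-idea-7 g6, memo §8.3] -/
def design (X : Fin (k + 1) × Fin (k + 1) → Bool) : Pos (k + 1) j → Pos (k + 1) j
  | pre t =>
    if ht : (t : ℕ) < 2 * (k + 1) then
      win 0 ⟨t / 2, by omega⟩ (τ (X (0, ⟨t / 2, by omega⟩)) (if (t : ℕ) % 2 = 0 then 2 else 3))
    else frD 0
  | frU s =>
    if hs : (s : ℕ) < k then win ⟨s + 1, by omega⟩ 0 (τ (X (⟨s + 1, by omega⟩, 0)) 2) else post 0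
  | win s i σ =>
    if τ (X (s, i)) σ = 0 then
      -- `U₁(s,i)` ↦ `D₂(s+1,i)` / `post (2i+1)`
      if hs : (s : ℕ) < k then win ⟨s + 1, by omega⟩ i (τ (X (⟨s + 1, by omega⟩, i)) 3)
      else post ⟨2 * i + 1, by omega⟩
    else if τ (X (s, i)) σ = 1 then
      -- `U₂(s,i)` ↦ `D₁(s+1,i+1)` / `frD (s+1)` / `post (2i+2)`
      if hs : (s : ℕ) < k then
        (if hi : (i : ℕ) < k then
          win ⟨s + 1, by omega⟩ ⟨i + 1, by omega⟩ (τ (X (⟨s + 1, by omega⟩, ⟨i + 1, by omega⟩)) 2)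
        else frD ⟨s + 1, by omega⟩)
      else post ⟨2 * i + 2, by omega⟩
    else if τ (X (s, i)) σ = 2 then
      -- `D₁(s,i)` ↦ `U₂(s−1,i−1)` / `frU (s−1)` / `pre (2i)`
      if hs : 0 < (s : ℕ) then
        (if hi : 0 < (i : ℕ) then
          win ⟨s - 1, by omega⟩ ⟨i - 1, by omega⟩ (τ (X (⟨s - 1, by omega⟩, ⟨i - 1, by omega⟩)) 1)
        else frU ⟨s - 1, by omega⟩)
      else pre ⟨2 * i, by omega⟩
    else
      -- `D₂(s,i)` ↦ `U₁(s−1,i)` / `pre (2i+1)`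
      if hs : 0 < (s : ℕ) then win ⟨s - 1, by omega⟩ i (τ (X (⟨s - 1, by omega⟩, i)) 0)
      else pre ⟨2 * i + 1, by omega⟩
  | frD s =>
    if hs : 0 < (s : ℕ) then win ⟨s - 1, by omega⟩ (Fin.last k) (τ (X (⟨s - 1, by omega⟩, Fin.last k)) 1)
    else pre ⟨2 * (k + 1), by omega⟩
  | post t =>
    if (t : ℕ) = 0 then frU (Fin.last k)
    else win (Fin.last k) ⟨((t : ℕ) - 1) / 2, by omega⟩
      (τ (X (Fin.last k, ⟨((t : ℕ) - 1) / 2, by omega⟩)) (if (t : ℕ) % 2 = 1 then 0 else 1))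
  | padU t => padD t
  | padD t => padU t

/-- **The letter** of position `p` in the layout-B word of `X`: `true` = `U` (an opener of `M_X`). [memo §8.3] -/
def isU (X : Fin (k + 1) × Fin (k + 1) → Bool) : Pos (k + 1) j → Bool
  | pre _ => true
  | frU _ => true
  | win s i σ => decide ((τ (X (s, i)) σ : ℕ) < 2)
  | frD _ => false
  | post _ => false
  | padU _ => true
  | padD _ => false

/-- **The rank potential `ρ_X`** (= the FIFO rank of the arc through the position; `R = 2k+3`): openers `pre t ↦ t`,
`frU s ↦ R(s+1)`, `U₁(s,i) ↦ R(s+1)+1+2i`, `U₂(s,i) ↦ R(s+1)+2+2i`, `padU t ↦ R(k+2)+t`; closers `D₁(s,i) ↦ Rs+2i`,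
`D₂(s,i) ↦ Rs+2i+1`, `frD s ↦ Rs+2k+2`, `post t ↦ R(k+1)+t`, `padD t ↦ R(k+2)+t`. [SPEC §3] -/
def rank (X : Fin (k + 1) × Fin (k + 1) → Bool) : Pos (k + 1) j → ℕ
  | pre t => t
  | frU s => (2 * k + 3) * (s + 1)
  | win s i σ =>
    if ((τ (X (s, i)) σ : Fin 4) : ℕ) < 2 then (2 * k + 3) * (s + 1) + 1 + 2 * i + (τ (X (s, i)) σ : ℕ)
    else (2 * k + 3) * s + 2 * i + ((τ (X (s, i)) σ : ℕ) - 2)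
  | frD s => (2 * k + 3) * s + (2 * k + 2)
  | post t => (2 * k + 3) * (k + 1) + t
  | padU t => (2 * k + 3) * (k + 2) + t
  | padD t => (2 * k + 3) * (k + 2) + t

/-- **The allowed arcs `E'`** (opener, closer) = the union over `X` of the arcs of `M_X`, listed by kind (SPEC §4):
preamble → window/frame of stretch `0`; frame `U` of `s` → `D₁`-slots of window `(s+1,0)` / postamble; VERTICAL
window `(s,i)` even slot → window `(s+1,i)` odd slot; DIAGONAL window `(s,i)` odd slot → window `(s+1,i+1)` even slot;
last window odd slot → frame `D` of the next stretch; last stretch → postamble; padding pairs.  `8(k+1)² + 2 + j` arcs.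
[val-idea-7 g6, memo §8.3 (`E*`); crit-3 VERDICT #18: 10/34/74/130 for r = 1..4] -/
def allowed : Set (Pos (k + 1) j × Pos (k + 1) j) :=
  {a | match a.1, a.2 with
    | pre t, win s i σ => (s : ℕ) = 0 ∧ (((t : ℕ) = 2 * i ∧ ((σ : ℕ) = 0 ∨ (σ : ℕ) = 2)) ∨
        ((t : ℕ) = 2 * i + 1 ∧ ((σ : ℕ) = 1 ∨ (σ : ℕ) = 3)))
    | pre t, frD s => (t : ℕ) = 2 * (k + 1) ∧ (s : ℕ) = 0
    | frU s, win s' i σ => (s' : ℕ) = s + 1 ∧ (i : ℕ) = 0 ∧ ((σ : ℕ) = 0 ∨ (σ : ℕ) = 2)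
    | frU s, post t => (s : ℕ) = k ∧ (t : ℕ) = 0
    | win s i σ, win s' i' σ' => (s' : ℕ) = s + 1 ∧
        (((i' : ℕ) = i ∧ ((σ : ℕ) = 0 ∨ (σ : ℕ) = 2) ∧ ((σ' : ℕ) = 1 ∨ (σ' : ℕ) = 3)) ∨
         ((i' : ℕ) = i + 1 ∧ ((σ : ℕ) = 1 ∨ (σ : ℕ) = 3) ∧ ((σ' : ℕ) = 0 ∨ (σ' : ℕ) = 2)))
    | win s i σ, frD s' => (s' : ℕ) = s + 1 ∧ (i : ℕ) = k ∧ ((σ : ℕ) = 1 ∨ (σ : ℕ) = 3)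
    | win s i σ, post t => (s : ℕ) = k ∧
        (((t : ℕ) = 2 * i + 1 ∧ ((σ : ℕ) = 0 ∨ (σ : ℕ) = 2)) ∨ ((t : ℕ) = 2 * i + 2 ∧ ((σ : ℕ) = 1 ∨ (σ : ℕ) = 3)))
    | padU t, padD t' => (t' : ℕ) = t
    | _, _ => False}

/-- **The read-out coordinates** (SPEC §4): for an interaction pair `u → v` of the queue grid and bits `(a, b)` the arc
`e^{ab}_{uv}` — VERTICAL `v = (s+1, i)`: (`U₁`-slot of bit `a` in window `u`, `D₂`-slot of bit `b` in window `v`);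
DIAGONAL `v = (s+1, i+1)`: (`U₂`-slot of `a`, `D₁`-slot of `b`); non-pairs ↦ `(pre 0, pre 0)` (never an arc).
[val-idea-7 g6, memo §8.3: "each interaction pair carries 4 indicator arcs (one per bit pair)"] -/
def coord (q : ((Fin (k + 1) × Fin (k + 1)) × (Fin (k + 1) × Fin (k + 1))) × Bool × Bool) :
    Pos (k + 1) j × Pos (k + 1) j :=
  if (q.1.2.1 : ℕ) = q.1.1.1 + 1 ∧ (q.1.2.2 : ℕ) = q.1.1.2 then
    (win q.1.1.1 q.1.1.2 (τ q.2.1 0), win q.1.2.1 q.1.2.2 (τ q.2.2 3))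
  else if (q.1.2.1 : ℕ) = q.1.1.1 + 1 ∧ (q.1.2.2 : ℕ) = q.1.1.2 + 1 then
    (win q.1.1.1 q.1.1.2 (τ q.2.1 1), win q.1.2.1 q.1.2.2 (τ q.2.2 2))
  else (pre 0, pre 0)

/-! ### Transport to `Fin N`, `N = 2((k+2)(2k+3) + j)` -/

/-- `M_X` as a map of `Fin N`. -/
noncomputable def designFin (X : Fin (k + 1) × Fin (k + 1) → Bool) :
    Fin (2 * ((k + 1 + 1) * (2 * (k + 1) + 1) + j)) → Fin (2 * ((k + 1 + 1) * (2 * (k + 1) + 1) + j)) :=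
  fun q => equivFin (k + 1) j (design X ((equivFin (k + 1) j).symm q))

/-- `E'` as a set of arcs of `Fin N`. -/
def allowedFin (k j : ℕ) :
    Set (Fin (2 * ((k + 1 + 1) * (2 * (k + 1) + 1) + j)) × Fin (2 * ((k + 1 + 1) * (2 * (k + 1) + 1) + j))) :=
  {a | (((equivFin (k + 1) j).symm a.1, (equivFin (k + 1) j).symm a.2)) ∈ (allowed : Set (Pos (k + 1) j × Pos (k + 1) j))}

/-- the read-out coordinates in `Fin N × Fin N`. -/
noncomputable def coordFin (j : ℕ) (q : ((Fin (k + 1) × Fin (k + 1)) × (Fin (k + 1) × Fin (k + 1))) × Bool × Bool) :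
    Fin (2 * ((k + 1 + 1) * (2 * (k + 1) + 1) + j)) × Fin (2 * ((k + 1 + 1) * (2 * (k + 1) + 1) + j)) :=
  (equivFin (k + 1) j (coord q).1, equivFin (k + 1) j (coord q).2)

end Pos

/-! ### Theorems-side verbatim copies of the line file's vocabulary (`Lines/queue_grid_face.lean`, val-idea-7 g6) -/

section Copies

open MvPolynomial
open scoped NNReal

variable {σ : Type}

/-- the exponent vector `d` as a real point [copy of `QueueGridFace.realOf` of the line file] -/
def realOf (d : σ →₀ ℕ) : σ → ℝ := fun i => ((d i : ℕ) : ℝ)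

/-- the support of `f` as a real point set [copy of the line file's `suppPts`] -/
def suppPts (f : MvPolynomial σ ℝ≥0) : Set (σ → ℝ) := realOf '' (f.support : Set (σ →₀ ℕ))

/-- the Newton polytope `Newt(f) = conv(supp f)` [copy of the line file's `newt`] -/
def newt (f : MvPolynomial σ ℝ≥0) : Set (σ → ℝ) := convexHull ℝ (suppPts f)

end Copies

/-- blocks of the `r`-queue grid [copy of the line file's `QGV`] -/
abbrev QGV (r : ℕ) := Fin r × Fin r

/-- the ORDERED interaction pairs `((s,i),(s+1,i))`, `((s,i),(s+1,i+1))` [copy of the line file's `qgEdge`] -/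
def qgEdge (r : ℕ) (p : QGV r × QGV r) : Bool :=
  (p.2.1.val == p.1.1.val + 1) && (p.2.2.val == p.1.2.val || p.2.2.val == p.1.2.val + 1)

/-- the pattern vector of a bit assignment [copy of the line file's `patternVec`] -/
noncomputable def patternVec (r : ℕ) (X : QGV r → Bool) : (QGV r × QGV r) × Bool × Bool → ℝ :=
  fun q => if qgEdge r q.1 = true ∧ X q.1.1 = q.2.1 ∧ X q.1.2 = q.2.2 then 1 else 0

/-- the PAIR-PATTERN polytope `PP_r = conv{patternVec X}` [copy of the line file's `queueGridPP`] -/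
noncomputable def queueGridPP (r : ℕ) : Set ((QGV r × QGV r) × Bool × Bool → ℝ) :=
  convexHull ℝ (Set.range (patternVec r))

end Summit.ValiantsHypothesis.ValiantsHypothesis.Theorems.FifoMatching.QueueGridFace
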